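import Mathlib
import Summits.Ventures.HodgeRepro.Tier4.Common.AdelicRTF
import Summits.Ventures.HodgeRepro.Tier4.Line1.RTFSetting
import Summits.Ventures.HodgeRepro.Tier4.Line1.FiniteLevelIsolation
import Summits.Ventures.HodgeRepro.Tier4.Line4.TorusProduct
import Summits.Ventures.HodgeRepro.Tier4.Line4.FinitePlacePositivity
import Summits.Ventures.HodgeRepro.Tier4.Line4.GASplit

/-!
# Tier4/Line4/ProductTestL1 — C-L4-D3COEFF, clause (i) of `D3CoeffData` modulo the archimedean print: an `L¹`
archimedean factor times a compactly supported finite factor is a continuous INTEGRABLE test function on `G(𝔸)`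

Blind re-derivation cell `pub-hodge-repro`, Tier 4 (README §9–§10), seat t4-L1-p5 (prover, gen 4; cut C-L4-D3COEFF,
lead (R-8) S14747; kernel shape S14811; paper proofs/t4/L4/D3COEFF-t4-L1-p5.md).  Target tree path
`lean/Summits/Ventures/HodgeRepro/Tier4/Line4/ProductTestL1.lean`.  Mathlib + L4-p1's GASplit (p696623: `G(𝔸) ≃ G_∞ × G_f`
with Haar uniqueness) + the PARTS laws (TorusProduct p695935, FinitePlacePositivity); no printed input.

WHAT IS PROVED.  plan-4 g4's §15 statements (work/v33/L1Class-STATEMENTS.lean Part C) ask of the archimedean test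
function `f = f_∞ ⊗ f_f` (the weight-3 coefficient at `w₀` tensored with a compactly supported finite part) that it be
an `L¹` PRODUCT test function: `IsProductFn`, continuous, integrable for the setting's Haar measure, finite factor of
compact support on `G(𝔸_f)`.  Here the integrability on `G(𝔸)` is REDUCED to the integrability of the archimedean
factor on `G_∞` — the one clause that is a print (Harish-Chandra: the weight-`k` coefficient is in `L¹` iff `k ≥ 3`,
lit-5 p698221 on `SL(2, ℝ)`):
* `integrable_ofInfPart_mul_ofFinPart` — for Haar measures `μ` on `G(𝔸)`, `μ_∞` on `G_∞`, `μ_f` on `G_f`: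
  `a ↦ f_∞(a)` integrable on `G_∞` and `b ↦ f_f(b)` integrable on `G_f` give `g ↦ f_∞(g_∞) · f_f(g_f)` integrable on
  `G(𝔸)` — Haar uniqueness `μ = c · (gaSplit⁻¹)_*(μ_∞ ⊗ μ_f)` (GASplit), the transport along the measurable
  equivalence, and Fubini's `Integrable.mul_prod`, with the PARTS laws identifying `(a · b)_∞ = a`, `(a · b)_f = b`;
* `integrable_finitePart_of_hasCompactSupport` — a continuous finite factor with compact support on `G_f` is
  integrable for every Haar measure on `G_f`;
* `continuous_ofInfPart_mul_ofFinPart` — the product is continuous (`continuous_ofInfPart`, `continuous_ofFinPart`);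
* **`isTestL1_prod_of_integrable_inf`** — the assembly: on a setting `S` on `G(𝔸)` (its `μ` Haar by `S.haar`), from
  `Continuous f_∞`, `Integrable (f_∞|_{G_∞}) μ_∞`, `Continuous f_f`, `HasCompactSupport (f_f|_{G_f})`:
  `Continuous f ∧ Integrable f S.μ` for `f g := f_∞ (g_∞) · f_f (g_f)` — typer-2's `IsTestL1 S f` (L1Convolution
  p697923) unfolded, the `cont` / `integrable` fields of plan-4's `IsTestL1Product`; `IsProductFn W f f_∞ f_f` holds by
  `rfl` and `finCompact` is the hypothesis.

Nothing here says anything about the status of the Hodge conjecture for CM abelian varieties, which is NOT proved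
(HC_CM is NOT proved by anyone in this repository).
-/

set_option autoImplicit false

noncomputable section

namespace Summit.Ventures.HodgeRepro.Tier4.Line4

open Summit.Ventures.HodgeRepro.Tier4.Common Summit.Ventures.HodgeRepro.Tier4.Line1 MeasureTheory NumberField

open scoped ENNReal NNReal

section ProductL1

variable {k : Type} [Field k] [NumberField k] (W : PlaneData k) [MeasurableSpace (GA W)] [BorelSpace (GA W)]

/-- **an `L¹` archimedean factor times an `L¹` finite factor is `L¹` on `G(𝔸)`**: Haar uniqueness on `G(𝔸)` (GASplit
`exists_smul_map_prod_eq_ga`), the transport along `gaSplit⁻¹`, Fubini (`Integrable.mul_prod`), and the PARTS laws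
`(a · b)_∞ = a`, `(a · b)_f = b` for `a ∈ G_∞`, `b ∈ G_f`. -/
theorem integrable_ofInfPart_mul_ofFinPart (μ : Measure (GA W)) [μ.IsHaarMeasure]
    (μinf : Measure (infinitePart W)) [μinf.IsHaarMeasure] (μfin : Measure (finitePart W)) [μfin.IsHaarMeasure]
    (finf ffin : GA W → ℂ) (hfi : Integrable (fun a : infinitePart W => finf (a : GA W)) μinf)
    (hffi : Integrable (fun b : finitePart W => ffin (b : GA W)) μfin) :
    Integrable (fun g : GA W => finf (GA.ofInfPart W g) * ffin (GA.ofFinPart W g)) μ := by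
  haveI := secondCountable_infinitePart W
  haveI := secondCountable_finitePart W
  obtain ⟨c, _, hμ⟩ := exists_smul_map_prod_eq_ga W μ μinf μfin
  subst hμ
  have hmeq : Measure.map (gaSplit W).symm (μinf.prod μfin) =
      Measure.map ((gaSplit W).symm.toHomeomorph.toMeasurableEquiv) (μinf.prod μfin) := rfl
  have hsm : (c • Measure.map (gaSplit W).symm (μinf.prod μfin) : Measure (GA W)) =
      ((c : ℝ≥0∞) • Measure.map (gaSplit W).symm (μinf.prod μfin)) := Measure.ext fun _ _ => rfl
  rw [hsm]
  refine Integrable.smul_measure ?_ ENNReal.coe_ne_top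
  rw [hmeq, integrable_map_equiv]
  have hprod : Integrable (fun p : infinitePart W × finitePart W => finf (p.1 : GA W) * ffin (p.2 : GA W))
      (μinf.prod μfin) := hfi.mul_prod hffi
  refine hprod.congr (Filter.Eventually.of_forall fun p => ?_)
  show finf (p.1 : GA W) * ffin (p.2 : GA W) =
    finf (GA.ofInfPart W ((p.1 : GA W) * (p.2 : GA W))) * ffin (GA.ofFinPart W ((p.1 : GA W) * (p.2 : GA W)))
  rw [ofInfPart_mul, ofFinPart_mul, ofInfPart_eq_self_of_mem_infinitePart W p.1.2,
    ofInfPart_eq_one_of_mem_finitePart W p.2.2, ofFinPart_eq_one_of_mem_infinitePart W p.1.2,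
    ofFinPart_eq_self_of_mem_finitePart W p.2.2, mul_one, one_mul]

/-- a continuous finite factor with compact support on `G_f` is integrable for every Haar measure on `G_f`. -/
theorem integrable_finitePart_of_hasCompactSupport (μfin : Measure (finitePart W)) [μfin.IsHaarMeasure]
    (ffin : GA W → ℂ) (hffc : Continuous ffin) (hffs : HasCompactSupport (fun b : finitePart W => ffin (b : GA W))) :
    Integrable (fun b : finitePart W => ffin (b : GA W)) μfin :=
  (hffc.comp continuous_subtype_val).integrable_of_hasCompactSupport hffs

omit [MeasurableSpace (GA W)] [BorelSpace (GA W)] in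
/-- the product of an archimedean and a finite factor is continuous on `G(𝔸)`. -/
theorem continuous_ofInfPart_mul_ofFinPart (finf ffin : GA W → ℂ) (hfc : Continuous finf)
    (hffc : Continuous ffin) :
    Continuous (fun g : GA W => finf (GA.ofInfPart W g) * ffin (GA.ofFinPart W g)) :=
  (hfc.comp (continuous_ofInfPart W)).mul (hffc.comp (continuous_ofFinPart W))

/-- **clause (i) of `D3CoeffData` modulo the archimedean print**: on a setting `S` on `G(𝔸)`, an archimedean factor
`f_∞` continuous on `G(𝔸)` and integrable on `G_∞` (the Harish-Chandra clause, DISPLAYED as `hfi`) and a finite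
factor `f_f` continuous with compact support on `G_f` give a continuous, `S.μ`-integrable product
`g ↦ f_∞(g_∞) · f_f(g_f)` — `IsTestL1 S f` unfolded (L1Convolution), the `cont` / `integrable` fields of plan-4's
`IsTestL1Product` (its `product` field is `rfl`, its `finCompact` field is `hffs`). -/
theorem isTestL1_prod_of_integrable_inf (S : RTF.Setting (GA W)) (μinf : Measure (infinitePart W))
    [μinf.IsHaarMeasure] (μfin : Measure (finitePart W)) [μfin.IsHaarMeasure] (finf ffin : GA W → ℂ)
    (hfc : Continuous finf) (hfi : Integrable (fun a : infinitePart W => finf (a : GA W)) μinf)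
    (hffc : Continuous ffin) (hffs : HasCompactSupport (fun b : finitePart W => ffin (b : GA W))) :
    Continuous (fun g : GA W => finf (GA.ofInfPart W g) * ffin (GA.ofFinPart W g)) ∧
      Integrable (fun g : GA W => finf (GA.ofInfPart W g) * ffin (GA.ofFinPart W g)) S.μ := by
  haveI : S.μ.IsHaarMeasure := S.haar
  exact ⟨continuous_ofInfPart_mul_ofFinPart W finf ffin hfc hffc,
    integrable_ofInfPart_mul_ofFinPart W S.μ μinf μfin finf ffin hfi
      (integrable_finitePart_of_hasCompactSupport W μfin ffin hffc hffs)⟩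

end ProductL1

end Summit.Ventures.HodgeRepro.Tier4.Line4

end
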